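import Literature.NumberTheory.DiophantineGeometry.BcgpSwitchExistsModularAbelianSurface
import Literature.NumberTheory.GaloisRepresentations.CrystallineOrdinaryShape
import Literature.NumberTheory.DiophantineGeometry.AVGaloisModule
import Literature.AlgebraicGeometry.Motives.AbelianVariety
import HarnessLib

/-!
# BCGP 2025, Lemma 10.4.1 along its printed proof, Galois type **B**[C₂]: residual modularity at the
# WREATH residues `SL₂(𝔽_p) ≀ ℤ/2` ⟹ modularity of the quadratically-imprimitive surfaces with
# `End_ℚ(A) = ℤ`

Topic `NumberTheory/DiophantineGeometry`, next to
`bcgp_serreSurjective_quadraticImprimitive_implies_endTrivialSurfacesModular` (the same printed lemma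
read at the SURJECTIVE residues, type **A**; its docstring records that type **B**[C₂] "would use the
hypothesis at residues of image `SL₂(𝔽_p) ≀ ℤ/2` instead" — this file is that reading) and
`bcgp_serreRegularWeight_implies_allAbelianSurfacesModular` (the lemma with its full hypothesis). One
named fact — a published IMPLICATION whose two brackets are written inline (a `Literature` file may not
import a `Theses` file, nor give an unproved hypothesis a `def` of its own); the hypothesis is not
asserted. No `sorry`, no new mathematical object. Requested by the line lead of crux stmt-Langlands-17766
(`AbelianSurfaceSerre.QuadraticImprimitiveSurfaces`, route `Langlands/AbelianSurfaceSerre`), whose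
registered stub `stub_wreathReduction` it is verbatim (consequent = the body of that route definition;
antecedent = the body of `RegularSerreAbelianSurfaces.OrdinarySerreGSp4`, item stmt-Langlands-17569,
with four hypotheses ADDED, so a WEAKER residual-modularity input than either sibling fact uses).
Since the verdict clean-up of 2026-08-17 (`## Verdict clean-up` below) the declaration
`bcgp_serreWreath_implies_quadraticImprimitiveSurfacesModular` (similitude of the automorphic lift
left free, `∃ μ`) is a `@[deprecated]` RECORD, no longer a named fact of the literature: it is
MISSTATED — stronger than the source — and kept verbatim only because two `Summits` modules still
apply it. The CORRECTED statement (similitude FIXED) is the named fact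
`bcgp_serreWreathFixedSimilitude_implies_quadraticImprimitiveSurfacesModular` of the companion
`BcgpSerreWreathFixedSimilitudeImprimitiveSurfaces.lean`.

Source: G. Boxer, F. Calegari, T. Gee, V. Pilloni, *Modularity theorems for abelian surfaces*,
arXiv:2502.20645 [BoxerCalegariGeePilloni2025]: §10.4 **Lemma 10.4.1** with **Remark 10.4.2** and its
PROOF (p. 146); §10.2 **Theorem 10.2.1**, **Remark 10.2.2** (pp. 138–139); **Definition 1.8.12**.

PRINTED STATEMENTS (quoted from the source, read 2026-08-17 from the arXiv text layer, pp. 138–139,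
146).

* Lemma 10.4.1. *Suppose that for every residual representation `ρ̄ : G_ℚ → GSp₄(𝔽_p)` satisfying
  the following conditions: `ρ̄` has multiplier `ε̄⁻¹`; `ρ̄` is absolutely irreducible; the
  semi-simplification of `ρ̄|_{G_{ℚ_p}}` is a direct sum of characters, there exists an ordinary
  cuspidal automorphic representation `π` of `GSp₄/ℚ` of regular weight, level prime to `p`, and
  central character `|·|²`, such that `ρ̄_{π,p} ≅ ρ̄`. Then all abelian surfaces `A/ℚ` are modular.*
  Remark 10.4.2: *"one could only demand the statement for `p` sufficiently large."*
* Its proof (p. 146), the part this fact records: *"By Theorem 10.2.1, we may assume that `A` is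
  'challenging' …, i.e. that either `End(A_ℚ̄) = ℤ`, or that `A` has Galois type **B**[C₂], so there
  exists a quadratic extension `K/ℚ` so that `E = End(A_K) ⊗ ℚ = End(A_ℚ̄) ⊗ ℚ` is either `ℚ ⊕ ℚ` or
  a real quadratic field. By [BCGP 2021], there is a density one set of primes `p > 2` such that `A`
  is ordinary at `p` and residually `p`-distinguished …, and moreover that `ρ̄ = ρ̄_{A,p}` satisfies
  the hypotheses listed in the statement of this lemma, as well as being vast … and tidy …
  Furthermore, we may assume that if `A` has Galois type **B**[C₂] then `p` splits in `E`. We now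
  deduce the modularity of `A` as a consequence of Theorem ('`ρ` is modular from multiplicity one
  and classicity') for `ρ = ρ_{A,p}` … Suppose firstly that `A` has Galois type **B**[C₂]. Then for
  sufficiently large primes `p` (splitting in `E`) the mod `p` representations
  `ρ̄_{A,p} : G_{K(ζ_{p^∞})} → SL₂(𝒪_E/p) = SL₂(𝔽_p) × SL₂(𝔽_p)`,
  `ρ̄_{A,p} : G_K → {(A,B) ∈ GL₂(𝔽_p) × GL₂(𝔽_p), det(A) = det(B)}` are surjective. (This follows
  from [BCGP 2021], and for `E = ℚ ⊕ ℚ` goes back to [Serre 1972].) Thus we may additionally assume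
  that `p` is chosen so that `K ⊄ ℚ(ζ_{p^∞})` and `ρ_{A,p}(G_{ℚ(ζ_{p^∞})})` is precisely
  `SL₂(𝔽_p) ≀ ℤ/2ℤ` … contains a regular semi-simple element with eigenvalues
  `(ζ₈, ζ₈⁻¹, −ζ₈, −ζ₈⁻¹)`. Thus condition (enormous) follows from Corollary 7.1.4. For `p > 5`,
  `ρ̄_{A,p}(G_ℚ)` contains `(A,B) = (diag(1,6), diag(2,3))`, which is regular semi-simple and which
  does not lie in `Sp₄(𝔽_p)` … since `ρ̄_{A,p}|_{G_{ℚ_p}}` is residually `p`-distinguished it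
  follows from [BCGP] that `Spec R_p^△[1/p]` is irreducible, and we are done."* So for type
  **B**[C₂] the hypothesis is invoked ONLY at `ρ̄ = ρ̄_{A,p}` for one large good prime `p` split in
  `E`, a residual representation that is symplectic of multiplier `ε̄⁻¹`, residually
  `p`-distinguished ordinary at `p`, with `ρ̄(G_K) = Δ_p := {(a,b) : det a = det b}` of order
  `p²(p−1)(p²−1)²` preserving the two planes (so `ρ̄|_{G_K}` is reducible) and `ρ̄(G_ℚ) ⊋ ρ̄(G_K)` of
  index two (an irreducible `ρ̄` cannot have the reducible image `Δ_p`), i.e. of order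
  `2p²(p−1)(p²−1)²`, and `ρ̄(G_{ℚ(ζ_p)}) ⊇ ρ̄(G_{ℚ(ζ_{p^∞})}) = SL₂(𝔽_p) ≀ ℤ/2` irreducible on `𝔽_p⁴`.
* Theorem 10.2.1 (p. 138). *Let `A/ℚ` be an abelian surface. Suppose that the Galois type of `A` is
  neither **A** nor **B**[C₂]. Then `A` is modular.* (proved there unconditionally, p. 139); p. 138:
  *"the Galois type of `A/ℚ` is **A** precisely when `End(A_ℚ̄) = ℤ`, and `A/ℚ` has type **B**[C₂]
  if there exists a quadratic field `K/ℚ` so that `End(A) = ℤ` but `End(A_K) ⊗ ℚ` is either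
  `ℚ ⊕ ℚ` or a real quadratic field"*; Remark 10.2.2 (p. 139): *"The modularity of such abelian
  surfaces remains open in general even for real quadratic fields `K`."*
* Definition 1.8.12. *`A/F` is modular if there exist C-algebraic cuspidal automorphic
  representations `π_i` for `GL_{n_i}/F` with `4 = Σ n_i` such that
  `L(s, H¹(A)) = ∏ L(s, π_i ⊗ |det|^{(1-n_i)/2})`.*

TYPED FORM — how the two brackets relate to the printed text (the points a reviewer or refuter
should attack).

* FIRST BRACKET (hypothesis = Serre at the wreath residues, `GL₄` proxy). It is the body of the route
  definition `RegularSerreAbelianSurfaces.OrdinarySerreGSp4` (the typed hypothesis of Lemma 10.4.1 in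
  the Remark 10.4.2 variant, whose relation to the printed `GSp₄` statement — descent `GL₄ → GSp₄`
  [cite: Arthur2013] [cite: GeeTaibi2019, §2], regular weight from regular algebraicity, level prime
  to `p` from unramifiedness at `p`, ordinarity from Greenberg-ordinarity of injective shape — is
  recorded in `BcgpSerreRegularWeightAbelianSurfacesModular.lean`) with FOUR HYPOTHESES ADDED on
  `ρ̄ : Γ_ℚ → GL₄(k)` (`k = k̄` of characteristic `p`): (i) the triangularisation on `Γ_{ℚ_p}` is
  residually `p`-distinguished (pairwise distinct diagonal characters, same conjugating `g`);
  (ii) `|ρ̄(Γ_ℚ)| = 2p²(p−1)(p²−1)² = |Δ_p ⋊ C₂|` (`Nat.card` of the range); (iii) `ρ̄|Γ_{ℚ(ζ_p)}`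
  irreducible (`CyclotomicField p ℚ`); (iv) `ρ̄|Γ_K` reducible for some quadratic number field `K`.
  By the proof quoted above, (i)–(iv) hold at every residual representation at which the printed
  proof invokes the Serre hypothesis for a surface of type **B**[C₂]; so the bracket is implied by
  the printed hypothesis of Lemma 10.4.1 and suffices for its type-**B**[C₂] branch. (The bracket
  does not pin the image down to the wreath group up to conjugacy — it need not: any hypothesis class
  CONTAINING those residues gives the implication.)
* SECOND BRACKET (conclusion = the body of `AbelianSurfaceSerre.QuadraticImprimitiveSurfaces`,
  stmt-Langlands-17766): for every abelian surface `A/ℚ` (`AbelianVariety ℚ`, `dim = 2`) with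
  `End_ℚ(A) = ℤ`, every `p`, `ℚ_p`-basis `b` of `V_p A`, the framed `r` of `Γ_ℚ` on
  `H¹_ét(A_ℚ̄, ℚ̄_p) = (V_p A)^∨ ⊗ ℚ̄_p` in the dual basis (frame clause verbatim from
  `bcgp_switch_exists_modular_abelianSurface`), IF `r|Γ_K` is reducible for some quadratic number
  field `K`, then for every level witness and `ι : ℚ̄_p ≃ ℂ` there is an L-algebraic cuspidal `π`
  on `GL₄(𝔸_ℚ)` whose Satake parameters give the arithmetic-Frobenius characteristic polynomials
  of `r` at almost all places (Definition 1.8.12, one factor `n₁ = 4`, the case forced by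
  `End_ℚ(A) = ℤ`: `V_p A` is absolutely irreducible [cite: Faltings1983Endlichkeit, Satz 4 and
  Korollar 1], so no isobaric sum can match).
* WHICH PRINTED RESULT COVERS WHICH SURFACE of the second bracket. By Faltings
  (`End_{Γ_K}(V_p A) = End_K(A) ⊗ ℚ_p`, `V_p A|Γ_K` semisimple) the hypothesis "`End_ℚ(A) = ℤ` and
  `r|Γ_K` reducible for a quadratic `K`" says `End_K(A) ≠ ℤ`, so `End(A_ℚ̄) ≠ ℤ` and the Galois
  type is not **A**. Type **B**[C₂]: the proof of Lemma 10.4.1 quoted above, with the first bracket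
  supplying `π` at `ρ̄_{A,p}`. Every other Galois type: Theorem 10.2.1, unconditionally.

So the typed implication is [proof of Lemma 10.4.1, case **B**[C₂], with Remark 10.4.2] ∘ [descent
`GL₄ → GSp₄` and ordinarity at `p`] + [Theorem 10.2.1] + [Faltings]; each a proved, published
result; the hypothesis is the open input and is not asserted here. Consumers take
`(h : bcgp_serreWreath_implies_quadraticImprimitiveSurfacesModular)`.

## Status (provefact seat, 2026-08-17): no discharge extractable; ONE clause over-claims — corrected
## in `BcgpSerreWreathFixedSimilitudeImprimitiveSurfaces.lean`

* SIZE OF A DISCHARGE. A proof of `…_holds` would have to formalise, on the tree's scheme-theoretic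
  `AbelianVariety` and adelic `CuspidalAutomorphicRepData`: the main theorem of the source, printed
  Thm. 7.5.8 "`ρ` is modular" with Prop. 7.5.7 (= §§2–7: higher Hida theory, Taylor–Wiles patching,
  `R_p^△`); Theorem 10.2.1; [BCGP 2021, §9.2] (density-one good primes, the images `Δ_p`,
  `SL₂(𝔽_p) ≀ ℤ/2`); Cor. 7.1.4; Arthur's transfer `GSp₄ ↔ GL₄` with local–global compatibility; and
  Faltings (Satz 3–4 over the quadratic field `K`, to exclude Galois type **A** from the second
  bracket). None is a theorem of Mathlib or of the tree; only Faltings EXISTS in the tree, as the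
  unproved named facts `Literature.AlgebraicGeometry.Motives.faltings_tate_bijective` and
  `Literature.AlgebraicGeometry.Motives.isSemisimpleRepresentation_rationalTateRep`. Triage XL.
* AUDIT. The typed brackets were re-read against the arXiv text (chunks 9, 11, 117–120, 138–141, 146
  of the text layer; the "p." locators above are these chunk numbers). Hypotheses (i)–(iv), the
  constant `2p²(p−1)(p²−1)² = |Δ_p ⋊ C₂|`, the multiplier `ε̄⁻¹` on `H¹`, the `m = 1`
  (L-)normalisation of the conclusion and the single cuspidal factor `n₁ = 4` check out. ONE clause
  does not: in the first bracket the automorphic lift is only asked to be symplectic for SOME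
  multiplier (`∃ μ, r.IsSymplecticWithMultiplierFun μ`), whereas the printed hypothesis (Lemma 10.4.1:
  "central character `|·|²`"; the source's standing convention, §1; Prop. 7.5.7: "`ν ∘ ρ = ε⁻¹`",
  "`π` … with central character `|·|²` such that `ρ̄_{π,p} ≃ ρ̄`") FIXES the similitude. At the wreath
  residues this is not harmless: an irreducible induced `ρ̄ = Ind_{Γ_K}^{Γ_ℚ} σ̄` carries
  non-degenerate alternating forms of BOTH multipliers `ε̄⁻¹` and `ε̄⁻¹χ_K`
  (`∧²(ρ̄^∨) ⊇ Ind(det σ̄^∨) = ε̄ ⊕ ε̄χ_K`), a lift of the class `ε̄⁻¹χ_K` passes every clause of the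
  typed bracket (for `K` real), and no modification preserving `ρ̄` brings it to central character
  `|·|²` (a twist `ψ` with `ρ̄ ⊗ ψ̄ ≅ ρ̄` has `ψ̄ ∈ {1, χ_K}`, `ψ² ≡ 1`). So THIS declaration accepts
  witnesses from which the printed proof cannot be run and is stronger than what the source proves;
  it is kept verbatim for its users but should be consumed through the corrected statement
  (multiplier EXACTLY `ε_p^{-(1+2s)}` with `p - 1 ∣ s`), which is the conclusion type of the theorem
  `bcgp_serreWreathFixedSimilitude_implies_quadraticImprimitiveSurfacesModular_of_serreWreath` in
  `BcgpSerreWreathFixedSimilitudeImprimitiveSurfaces.lean` (proved from this declaration: old ⟹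
  corrected; full discussion and both directions of the comparison with the printed hypothesis
  there) and is meanwhile NAMED there, by a definition proposal of the route side, as the fact
  `bcgp_serreWreathFixedSimilitude_implies_quadraticImprimitiveSurfacesModular`. The same clause
  occurs in the sibling facts `bcgp_serreRegularWeight_implies_allAbelianSurfacesModular` (same
  defect at its type-**B**[C₂] surfaces; meanwhile a `@[deprecated]` record) and
  `bcgp_serreSurjective_quadraticImprimitive_implies_endTrivialSurfacesModular` (unique similitude
  class at type-**A** residues: UNAFFECTED — the Tate-parity normalisation `p - 1 ∣ s` is restored at
  level prime to `p` by Hida theory [cite: Pilloni2012, Thm 1.1 (1), (6), (7)], as the companion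
  file, §"Why it matters", and the sibling file, `## Review 4`, explain; this corrects the
  2026-08-17 wording "only the `p - 1 ∣ s` weight normalisation is at issue").

## Verdict clean-up (provefact seat, cycle 4, 2026-08-17): record DEPRECATED; corrected statement = the named fact of the companion file

The verdict `misstated` (`## Status`) was re-derived this cycle and reconciled with the independent
audits of the sibling `BcgpSerreRegularWeightAbelianSurfacesModular.lean` (`## Review`–`## Review 4`,
`## Verdict clean-up`), with which it agrees: the over-claim is the similitude CLASS of the
automorphic lift, decisive at the wreath residues with `K` real and nowhere else (for `K` imaginary
the second class `ε̄⁻¹χ_K` is even and excluded by the sign theorem; the Tate-parity point is a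
normalisation restored by Hida theory, not a defect), and the surfaces of the second bracket on
which the recorded implication exceeds the published record are those of type **B**[C₂] with `A_K`
simple and `K` real — certainly when a prime `≡ 3 (mod 4)` ramifies in `K`, where not even a twist
`ψ² = χ_K` exists (companion file, `## Review`). Treatment, following the human ruling of 2026-08-15
("restate by default; keep the old name when meaning-preserving, else new name + `@[deprecated]`")
exactly as executed for the sibling record:

* the CORRECTED statement — verbatim this declaration with `∃ μ, r.IsSymplecticWithMultiplierFun μ`
  replaced by `∃ s : ℕ, p - 1 ∣ s ∧ r.IsSymplecticWithMultiplierFun (g ↦ ε_p(g)^{-(1+2s)})` — is the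
  named fact `bcgp_serreWreathFixedSimilitude_implies_quadraticImprimitiveSurfacesModular` of
  `BcgpSerreWreathFixedSimilitudeImprimitiveSurfaces.lean` (faithful to the source, audited there,
  `## Status`; it is the registered crux stmt-Langlands-18078 of route `Langlands/AbelianSurfaceSerre`
  and is PROVED from this declaration by `…_of_serreWreath'`). The correction is NOT
  meaning-preserving for the users of the old name (it strengthens the hypothesis bracket, which two
  `Summits` modules feed with the verbatim `∃ μ` bracket), so the old name is not re-bodied;
* THIS declaration keeps its body (byte-identical) and its ledger-referenced name and is
  `@[deprecated]` (text pointer to the corrected fact); it is no longer literature debt and no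
  `…_holds` is expected for it. Its users: the two comparison theorems of the companion file
  (`…_of_serreWreath`, `…_of_serreWreath'`, kept live there with `linter.deprecated` off for them
  only), the already deprecated bookkeeping theorem
  `bcgp_serreRegularWeight_implies_allAbelianSurfacesModular_of_wreath_of_primitive` of
  `BcgpSerreRegularWeightAbelianSurfacesModularProofs.lean` (no warning inside a deprecated
  declaration), and the `Summits` modules
  `…/Theorems/AbelianSurfaceSerreQuadraticImprimitiveSurfacesOfOrdinarySerre.lean`
  (`…_iff` by `Iff.rfl`, `QuadraticImprimitiveSurfaces_of_wreathFact (hX : …)`) and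
  `…/Theorems/AbelianSurfaceSerreQuadraticImprimitiveSurfacesOfWreathItems.lean`, which now see the
  deprecation warning — their route has already re-based the crux on the corrected fact (items
  stmt-Langlands-18072, stmt-Langlands-18078), so rewiring them is the line's bookkeeping.

## References

* [BoxerCalegariGeePilloni2025] G. Boxer, F. Calegari, T. Gee, V. Pilloni, *Modularity theorems
  for abelian surfaces*, arXiv:2502.20645: Lemma 10.4.1, Remark 10.4.2 and proof p. 146 (type
  **B**[C₂] paragraph); Theorem 10.2.1, Remark 10.2.2 (pp. 138–139); Definition 1.8.12; §1.8.10;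
  Corollary 7.1.4 (integrally enormous in the induced case).
* [BoxerEtAl2021] G. Boxer, F. Calegari, T. Gee, V. Pilloni, *Abelian surfaces over totally real
  fields are potentially modular*, Publ. Math. IHÉS 134 (2021), §9.2 (challenging surfaces: big
  image, good primes of density one; Lemma 7.5.21–7.5.23 for the induced images).
* [Serre1972] J.-P. Serre, *Propriétés galoisiennes des points d'ordre fini des courbes
  elliptiques*, Invent. Math. 15 (1972) (open image for pairs of non-isogenous curves, MR387283).
* [Faltings1983Endlichkeit] G. Faltings, *Endlichkeitssätze für abelsche Varietäten über
  Zahlkörpern*, Invent. Math. 73 (1983), Satz 3, Satz 4, Korollar 1.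
* [Arthur2013] J. Arthur, *The endoscopic classification of representations*, AMS Colloq. Publ. 61.
* [GeeTaibi2019] T. Gee, O. Taïbi, *Arthur's multiplicity formula for GSp₄ and restriction to
  Sp₄*, J. Éc. polytech. Math. 6 (2019), §2.
* [Pilloni2012] V. Pilloni, *Sur la théorie de Hida pour le groupe GSp_{2g}*, Bull. SMF 140 (2012),
  Thm 1.1 (1), (6), (7) (p. 337) (`## Status`: why the type-**A** sibling is unaffected; not used
  by the declaration).
-/

namespace Literature.NumberTheory.DiophantineGeometry

/-- **DEPRECATED (provefact seat, verdict clean-up 2026-08-17): MISSTATED — stronger than its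
source. The CORRECTED statement is the named fact
`Literature.NumberTheory.DiophantineGeometry.bcgp_serreWreathFixedSimilitude_implies_quadraticImprimitiveSurfacesModular`
(`BcgpSerreWreathFixedSimilitudeImprimitiveSurfaces.lean`, where it is audited as faithful and
PROVED from this declaration), which differs from this statement in exactly one clause of the
hypothesis bracket: the automorphic lift `r` is symplectic with multiplier EXACTLY `ε_p^{-(1+2s)}`,
`p - 1 ∣ s`, instead of "for SOME multiplier `μ`". What was wrong: the printed hypothesis of Lemma
10.4.1 asks for `π` on `GSp₄/ℚ` with central character `|·|²` (so `ν ∘ ρ_{π,p} = ε⁻¹` exactly,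
§1.8.9; Prop. 7.5.7, which the printed proof runs at `ρ = ρ_{A,p}`, has `ν ∘ ρ = ε⁻¹`), whereas
this bracket lets `r` be symplectic for some `μ` with congruence to `ρ̄` through characteristic
polynomials only; a wreath residue `ρ̄ = Ind_{Γ_K}^{Γ_ℚ} σ̄` carries invariant alternating forms of
BOTH multipliers `ε̄⁻¹` and `ε̄⁻¹χ_K`, and for `K` real a non-induced lift of the second class passes
every clause of the bracket and is consumed by no statement of the source (its descent has central
character of finite part `χ_K`; no twist preserving `ρ̄` changes the class). So the typed HYPOTHESIS
is weaker and this typed IMPLICATION stronger than Lemma 10.4.1 along its proof — on the surfaces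
of type **B**[C₂] with `A_K` simple and `K` real it exceeds the published record (module docstring
`## Status`, `## Verdict clean-up`; companion file `## Review`). Kept VERBATIM (body unchanged)
under its ledger-referenced name because two `Summits` modules of route `Langlands/AbelianSurfaceSerre`
and the companion's comparison theorems still apply it; it implies the corrected fact
(`…_of_serreWreath'` there). No `…_holds` is expected for this declaration; it is not literature
debt.**
Original description. **BCGP 2025 Lemma 10.4.1 along its printed proof (type B[C₂] branch, p. 146,
with Remark 10.4.2), Theorem 10.2.1 and Faltings — typed for crux
`AbelianSurfaceSerre.QuadraticImprimitiveSurfaces`.**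
IF (first bracket) for all large `p` every irreducible `ρ̄ : Γ_ℚ → GL₄(k)` (`k = k̄` of
characteristic `p`), symplectic with multiplier `ε̄_p⁻¹`, residually `p`-distinguished
triangularisable on `Γ_{ℚ_p}`, with image of order `2p²(p−1)(p²−1)² = |Δ_p ⋊ C₂|`, irreducible on
`Γ_{ℚ(ζ_p)}` and reducible on `Γ_K` for some quadratic `K` — the residues `ρ̄_{A,p}` of type-**B**[C₂]
surfaces at large good split primes — is congruent to the Greenberg-ordinary symplectic `r = r_{Π,ι}`
of a regular algebraic cuspidal `Π` on `GL₄(𝔸_ℚ)` unramified at `p` (the residual-modularity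
hypothesis of Lemma 10.4.1 at exactly the residues its proof uses for type **B**[C₂], read through
the `GL₄` proxy), THEN (second bracket) every abelian surface `A/ℚ` with `End_ℚ(A) = ℤ` whose
`p`-adic `H¹` becomes reducible over some quadratic field is modular: an L-algebraic cuspidal `π` on
`GL₄(𝔸_ℚ)` with cofinite Satake–Frobenius matching (Definition 1.8.12, one factor). INTENDED
reading: [proof of Lemma 10.4.1, type **B**[C₂], p. 146] ∘ [descent `GL₄ → GSp₄`] + [Theorem 10.2.1
for the other Galois types of the second bracket] + [Faltings, excluding type **A**] — see the module
docstring; the hypothesis is not asserted here.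
MIS-RENDERED (similitude of the lift left free); corrected as said above.
[cite: BoxerCalegariGeePilloni2025, Lemma 10.4.1 proof p. 146 (type B[C₂]), Rem. 10.4.2; Thm 10.2.1; Rem. 10.2.2; Def. 1.8.12]
[cite: BoxerEtAl2021, §9.2 (big image and good primes of density one for challenging surfaces)]
[cite: Faltings1983Endlichkeit, Satz 3, Satz 4, Korollar 1]
[cite: Arthur2013, Thm 1.5.2 (descent GL₄ → GSp₄ used to read the GL₄ proxy)]
[cite: GeeTaibi2019, §2 (Arthur's classification for GSp₄)] -/
@[deprecated "misstated (the hypothesis bracket leaves the similitude of the automorphic lift \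
free, `∃ μ`, while BCGP 2025 Lemma 10.4.1 / §1.8.9 / Prop. 7.5.7 fix the central character |·|², \
i.e. ν ∘ ρ_{π,p} = ε⁻¹; at the wreath residues with K real a lift of the second similitude class \
ε̄⁻¹χ_K passes the bracket, so this typed implication is stronger than the source): use the \
corrected named fact \
Literature.NumberTheory.DiophantineGeometry.bcgp_serreWreathFixedSimilitude_implies_quadraticImprimitiveSurfacesModular \
(BcgpSerreWreathFixedSimilitudeImprimitiveSurfaces.lean), which this declaration implies"
  (since := "2026-08-17")]
def bcgp_serreWreath_implies_quadraticImprimitiveSurfacesModular : Prop :=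
    (∃ P₀ : ℕ, ∀ (p : ℕ) [Fact p.Prime], P₀ ≤ p → ∀ (k : Type) [Field k] [CharP k p] [IsAlgClosed k]
    [TopologicalSpace k] [DiscreteTopology k] (red : Valued.integer (PadicAlgCl p) →+* k) (ρb :
    Literature.NumberTheory.GaloisRepresentations.FramedGaloisRep ℚ k 4),
    ρb.toGaloisRep.IsIrreducible → ρb.IsSymplecticWithMultiplierFun (fun g => (((Units.map
    (ZMod.castHom (dvd_refl p) k).toMonoidHom ((modularCyclotomicCharacter (AlgebraicClosure ℚ)
    (HasEnoughRootsOfUnity.natCard_rootsOfUnity (AlgebraicClosure ℚ) p)).comp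
    (MulSemiringAction.toRingAut (Field.absoluteGaloisGroup ℚ) (AlgebraicClosure ℚ)) g))⁻¹ : kˣ) :
    k)) → (∀ v : IsDedekindDomain.HeightOneSpectrum (NumberField.RingOfIntegers ℚ), ((p : ℕ) :
    NumberField.RingOfIntegers ℚ) ∈ v.asIdeal → ∃ g : Matrix.GeneralLinearGroup (Fin 4) k, (∀ (τ :
    Field.absoluteGaloisGroup (v.adicCompletion ℚ)) (i j : Fin 4), j < i → (g * ρb.toLocal v τ *
    g⁻¹).val i j = 0) ∧ ∀ i j : Fin 4, i ≠ j → ∃ τ : Field.absoluteGaloisGroup (v.adicCompletion ℚ),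
    (g * ρb.toLocal v τ * g⁻¹).val i i ≠ (g * ρb.toLocal v τ * g⁻¹).val j j) → Nat.card
    ρb.toMonoidHom.range = 2 * p ^ 2 * (p - 1) * (p ^ 2 - 1) ^ 2 → (ρb.restrictField
    (CyclotomicField p ℚ)).toGaloisRep.IsIrreducible → (∃ (K : Type) (_ : Field K) (_ : NumberField
    K), Module.finrank ℚ K = 2 ∧ ¬ (ρb.restrictField K).toGaloisRep.IsIrreducible) → ∀ (hcpt :
    Literature.NumberTheory.Automorphic.isCompact_glFiniteIntegralLevel 4 ℚ) (ι : PadicAlgCl p ≃+*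
    ℂ), ∃ (π : Literature.NumberTheory.Automorphic.CuspidalAutomorphicRepData 4 ℚ hcpt) (r :
    Literature.NumberTheory.GaloisRepresentations.FramedGaloisRep ℚ (PadicAlgCl p) 4),
    π.1.IsRegularAlgebraic ∧ (∀ v : IsDedekindDomain.HeightOneSpectrum (NumberField.RingOfIntegers
    ℚ), ((p : ℕ) : NumberField.RingOfIntegers ℚ) ∈ v.asIdeal → π.1.IsUnramifiedAt v) ∧ (∃ μ :
    Field.absoluteGaloisGroup ℚ → PadicAlgCl p, r.IsSymplecticWithMultiplierFun μ) ∧ (∀ v :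
    IsDedekindDomain.HeightOneSpectrum (NumberField.RingOfIntegers ℚ), ((p : ℕ) :
    NumberField.RingOfIntegers ℚ) ∈ v.asIdeal → ∃ a : Fin 4 → ℕ, Function.Injective a ∧
    r.IsGreenbergOrdinaryOfShapeAt v a) ∧ (∀ᶠ v : IsDedekindDomain.HeightOneSpectrum
    (NumberField.RingOfIntegers ℚ) in Filter.cofinite, ∃ α : Multiset ℂ, π.1.HasSatakeParamAt v α ∧
    r.IsUnramifiedAt v ∧ r.HasFrobCharpolyAt v
    (Literature.NumberTheory.Automorphic.arithFrobPolyOfSatake ι v.residueCard 4 α)) ∧ (∀ᶠ v :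
    IsDedekindDomain.HeightOneSpectrum (NumberField.RingOfIntegers ℚ) in Filter.cofinite,
    r.IsUnramifiedAt v ∧ ρb.IsUnramifiedAt v ∧ ∃ (P : Polynomial (Valued.integer (PadicAlgCl p)))
    (Pb : Polynomial k), r.HasFrobCharpolyAt v (P.map (Valued.integer (PadicAlgCl p)).subtype) ∧
    ρb.HasFrobCharpolyAt v Pb ∧ P.map red = Pb)) →
    ∀ (A : Literature.AlgebraicGeometry.Motives.AbelianVariety ℚ), A.dim = 2 → (∀ f : A ⟶ A, ∃ n :
    ℤ, f = n • CategoryTheory.CategoryStruct.id A) → ∀ (p : ℕ) [Fact p.Prime] (b : Module.Basis (Fin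
    4) ℚ_[p] (A.rationalTateModule p)) (r :
    Literature.NumberTheory.GaloisRepresentations.FramedGaloisRep ℚ (PadicAlgCl p) 4), (∀ g :
    Field.absoluteGaloisGroup ℚ, (r g).val = ((LinearMap.toMatrix b b (A.rationalTateRep p g⁻¹)).map
    (algebraMap ℚ_[p] (PadicAlgCl p))).transpose) → (∃ (K : Type) (_ : Field K) (_ : NumberField K),
    Module.finrank ℚ K = 2 ∧ ¬ Literature.NumberTheory.GaloisRepresentations.FramedRep.IsIrreducible
    (r.restrictField K)) → ∀ (hcpt :
    Literature.NumberTheory.Automorphic.isCompact_glFiniteIntegralLevel 4 ℚ) (ι : PadicAlgCl p ≃+*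
    ℂ), ∃ π : Literature.NumberTheory.Automorphic.CuspidalAutomorphicRepData 4 ℚ hcpt,
    π.1.IsLAlgebraic ∧ ∀ᶠ v : IsDedekindDomain.HeightOneSpectrum (NumberField.RingOfIntegers ℚ) in
    Filter.cofinite, ∃ a : Multiset ℂ, π.1.HasSatakeParamAt v a ∧ r.IsUnramifiedAt v ∧
    r.HasFrobCharpolyAt v (Literature.NumberTheory.Automorphic.arithFrobPolyOfSatake ι v.residueCard
    1 a)


end Literature.NumberTheory.DiophantineGeometry
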